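import Summits.BirchSwinnertonDyer.BirchSwinnertonDyer.Theorems.ManinLocalTwoThreeRatioBridge
import Summits.BirchSwinnertonDyer.BirchSwinnertonDyer.Theorems.ManinLocalTwoThreeEulerTruncationsFortyFour
import Literature.NumberTheory.ModularForms.QExpansionDerivative
import Literature.NumberTheory.ModularForms.QExpansionAlgebra
import Literature.NumberTheory.EllipticCurves.ModularCurveSturmProofs
import Literature.NumberTheory.EllipticCurves.ModularCurveGamma0IndexProofs
import Literature.NumberTheory.EllipticCurves.KleinJIntegralQExpansion
import HarnessLib

/-!
# Bracket–Sturm packaging, file 1/4: THE DEFINITIONS — the bracket / cubic / defect modular forms, the formal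
# `θ`-calculus, the kernel-computable list model, and the `η`-numerator / denominator tables

Cell bsd-f2-manin, route `ManinLocalTwoThree` (cruxes C2 `ManinOddAtFour` stmt-22967, C3 `ManinPrimeToThreeAtNine`
stmt-22968).  AUTHOR: planner seat -an gen 53 (TURNKEYS T-an-g53-BS v1.1 `bdf541700739eea7` and T-an-g53-EC
`195407b5d8884464`, HOME/an/g53/); landed by prover seat p2 gen 29, who only SPLIT the two turnkeys into four tree files
(`…BracketSturmDefs` ⊂ `…BracketSturm` ⊂ `…BracketSturmLists` ⊂ `…EtaCoefficientTables`) for the 400-line lint, all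
definitions going to the first; the Lean bodies are byte-identical to the turnkeys section by section.  Fact-free,
standard axioms, `--supports` helper; nothing here proves C2/C3 for all `N`, Manin's conjecture or BSD.

CONTENTS (definitions with their pointwise / entrywise API only; every analytic theorem is in files 2–4):
* §1 `serreForm A = ϑ_k A ∈ M_{k+2}(Γ₀(N))`, `bracketForm A B = ϑA·B − A·ϑB ∈ M_{2k+2}`, `cubicForm A B g₂ g₃ =
  4A³ − g₂AB² − g₃B³ ∈ M_{3k}`, `ofCusp f`, `defectForm A B f g₂ g₃ = [A,B]² − f²·cubic·B ∈ M_{4k+4}(Γ₀(N))` — the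
  ratio-bridge identity `(X′)² = (2πif)²(4X³ − g₂X − g₃)` for `X = A/B` as ONE modular form;
* §2 the formal side over any commutative ring: `theta` (`q·d/dq` on `R⟦X⟧`), `formalBracket`, `formalCubic`,
  `formalDefect` (denominators cleared by an integer `e`: `(e, c₀, c₂, c₃) = (e, 4e, e·g₂, e·g₃)`);
* §3 the kernel-computable model on coefficient LISTS of length `M`: `addPoly`, `mulPoly`, `mulList`, `subList`,
  `smulList`, `thetaList`, `bracketList`, `cubicList`, `defectList`, with the `getD` bookkeeping lemmas;
* §4 computable `η`-tables: `oneList`, `powList`, `shiftList`, `addList`, `eulerScaledList M δ` (first `M` coefficients of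
  `∏(1 − X^{δn})`, read off `EulerTables.eulerTruncList`), `divisorsList`, `eulerProdList`, `etaNumList M N r a =
  X^a·∏_δ(φ_δ^∧)^{(r_δ)⁺}`, `etaDenList M N r = ∏_δ(φ_δ^∧)^{(−r_δ)⁺}`, and the analytic product `eulerProdFn`.
[cite: Zagier2008, §5.1 Prop. 15] [cite: Manin1972, Prop. 1.4] [cite: Koehler2011, §1.1, §2.1] [cite: Sturm1987, Thm. 1]
-/

set_option autoImplicit false
-- lint-debt: the directory name repeats the summit name (sibling precedent `ManinLocalTwoThreeRatioBridge.lean`)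
set_option linter.dupNamespace false

noncomputable section

open Complex Filter Topology Set Function Asymptotics
open UpperHalfPlane hiding I
open scoped Real Topology Manifold MatrixGroups ModularForm PeriodPair
open CongruenceSubgroup Derivative PowerSeries
open Literature.NumberTheory.ModularForms
open Literature.NumberTheory.EllipticCurves Literature.NumberTheory.EllipticCurves.ModularForms

namespace Summit.BirchSwinnertonDyer.BirchSwinnertonDyer.Theorems.ManinLocalTwoThree.BracketSturm

open RatioBridge

variable {N : ℕ} [NeZero N] {k : ℤ}

/-! ## §1 The bracket, the cubic and the defect as modular forms on `Γ₀(N)` -/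

/-- **The Serre derivative `ϑ_k A = DA − (k/12)E₂A ∈ M_{k+2}(Γ₀(N))` of `A ∈ M_k(Γ₀(N))`** as a modular form
(the tree's `Level.serreDerivative_mem`: equivariance is Mathlib's, boundedness at every cusp from the periodicity
of the `SL₂(ℤ)`-translates). [cite: Zagier2008, §5.1 Prop. 15] -/
def serreForm (A : ModularForm (Gamma0 N) k) : ModularForm (Gamma0 N) (k + 2) :=
  (mem_formSpace.mp (Level.serreDerivative_mem (Gamma0 N) (coe_mem_formSpace A))).choose

/-- Its underlying function is `ϑ_k A`. [cite: Zagier2008, §5.1 Prop. 15] -/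
theorem coe_serreForm (A : ModularForm (Gamma0 N) k) : (serreForm A : ℍ → ℂ) = serreDerivative k ⇑A :=
  (mem_formSpace.mp (Level.serreDerivative_mem (Gamma0 N) (coe_mem_formSpace A))).choose_spec

/-- **The bracket `[A, B] = ϑA·B − A·ϑB ∈ M_{2k+2}(Γ₀(N))`** (`ϑ` the Serre derivative; the `E₂`-terms cancel).
[cite: Zagier2008, §5.1 Prop. 15] -/
def bracketForm (A B : ModularForm (Gamma0 N) k) : ModularForm (Gamma0 N) (2 * k + 2) :=
  ((serreForm A).mul B).mcast (by ring) - (A.mul (serreForm B)).mcast (by ring)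

/-- Pointwise `[A, B](τ) = DA(τ)·B(τ) − A(τ)·DB(τ)`. [cite: Zagier2008, §5.1] -/
theorem bracketForm_apply (A B : ModularForm (Gamma0 N) k) (τ : ℍ) :
    bracketForm A B τ = D ⇑A τ * B τ - A τ * D ⇑B τ := by
  simp only [bracketForm, ModularForm.sub_apply, ModularForm.coe_mcast, ModularForm.coe_mul, Pi.mul_apply,
    coe_serreForm, serreDerivative_apply]
  ring

/-- **The cubic `4A³ − g₂AB² − g₃B³ ∈ M_{3k}(Γ₀(N))`.** [folklore] -/
def cubicForm (A B : ModularForm (Gamma0 N) k) (g₂ g₃ : ℂ) : ModularForm (Gamma0 N) (3 * k) :=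
  ((4 : ℂ) • (A.mul A).mul A - g₂ • (A.mul B).mul B - g₃ • (B.mul B).mul B).mcast (by ring)

/-- Pointwise `cubicForm A B g₂ g₃ τ = 4A(τ)³ − g₂A(τ)B(τ)² − g₃B(τ)³`. [folklore] -/
theorem cubicForm_apply (A B : ModularForm (Gamma0 N) k) (g₂ g₃ : ℂ) (τ : ℍ) :
    cubicForm A B g₂ g₃ τ = 4 * A τ ^ 3 - g₂ * A τ * B τ ^ 2 - g₃ * B τ ^ 3 := by
  simp only [cubicForm, ModularForm.coe_mcast, ModularForm.sub_apply, ModularForm.IsGLPos.smul_apply,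
    ModularForm.coe_mul, Pi.mul_apply, smul_eq_mul]
  ring

/-- The cusp form `f` viewed as a modular form (Mathlib `ModularFormClass.modularForm`). [folklore] -/
def ofCusp (f : CuspForm (Gamma0 N) 2) : ModularForm (Gamma0 N) 2 := ModularFormClass.modularForm f

omit [NeZero N] in
/-- Its underlying function is `f`. [folklore] -/
@[simp] theorem coe_ofCusp (f : CuspForm (Gamma0 N) 2) : (ofCusp f : ℍ → ℂ) = ⇑f := rfl

/-- **THE DEFECT `[A,B]² − f²·(4A³ − g₂AB² − g₃B³)·B ∈ M_{4k+4}(Γ₀(N))`** — the bracket identity of the ratio bridge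
as ONE modular form. [cite: Manin1972, Prop. 1.4] [cite: Zagier2008, §5.1 Prop. 15] -/
def defectForm (A B : ModularForm (Gamma0 N) k) (f : CuspForm (Gamma0 N) 2) (g₂ g₃ : ℂ) :
    ModularForm (Gamma0 N) (4 * k + 4) :=
  ((bracketForm A B).mul (bracketForm A B)).mcast (by ring) -
    ((((ofCusp f).mul (ofCusp f)).mul (cubicForm A B g₂ g₃)).mul B).mcast (by ring)

/-- Pointwise value of the defect. [folklore] -/
theorem defectForm_apply (A B : ModularForm (Gamma0 N) k) (f : CuspForm (Gamma0 N) 2) (g₂ g₃ : ℂ) (τ : ℍ) :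
    defectForm A B f g₂ g₃ τ =
      (D ⇑A τ * B τ - A τ * D ⇑B τ) ^ 2 - f τ ^ 2 * (4 * A τ ^ 3 - g₂ * A τ * B τ ^ 2 - g₃ * B τ ^ 3) * B τ := by
  simp only [defectForm, ModularForm.sub_apply, ModularForm.coe_mcast, ModularForm.coe_mul, Pi.mul_apply,
    bracketForm_apply, cubicForm_apply, coe_ofCusp]
  ring

/-! ## §2 The formal side: `θ = q·d/dq`, the formal bracket / cubic / defect -/

section Formal

variable {R : Type*} [CommRing R]

/-- `θ = q·d/dq` on formal power series: `θ(∑ aₙqⁿ) = ∑ n·aₙ qⁿ`. [cite: Zagier2008, §5.1] -/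
def theta (ψ : R⟦X⟧) : R⟦X⟧ := PowerSeries.mk fun n : ℕ ↦ (n : R) * coeff n ψ

/-- Coefficients of `θψ`. [cite: Zagier2008, §5.1] -/
@[simp] theorem coeff_theta (ψ : R⟦X⟧) (n : ℕ) : coeff n (theta ψ) = n * coeff n ψ := by
  rw [theta, coeff_mk]

/-- The formal bracket `θa·b − a·θb`. [folklore] -/
def formalBracket (a b : R⟦X⟧) : R⟦X⟧ := theta a * b - a * theta b

/-- The formal cubic `c₀a³ − c₂ab² − c₃b³` (for the defect: `(c₀, c₂, c₃) = e·(4, g₂, g₃)`). [folklore] -/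
def formalCubic (c₀ c₂ c₃ : R) (a b : R⟦X⟧) : R⟦X⟧ :=
  PowerSeries.C c₀ * (a * a * a) - PowerSeries.C c₂ * (a * (b * b)) - PowerSeries.C c₃ * (b * b * b)

/-- The formal defect `e·(θa·b − a·θb)² − φ²·(c₀a³ − c₂ab² − c₃b³)·b`. [folklore] -/
def formalDefect (e c₀ c₂ c₃ : R) (a b φ : R⟦X⟧) : R⟦X⟧ :=
  PowerSeries.C e * (formalBracket a b * formalBracket a b) - φ * φ * formalCubic c₀ c₂ c₃ a b * b

/-- Scaling the cubic: `e·cubic(c₀, c₂, c₃) = cubic(e c₀, e c₂, e c₃)`. [folklore] -/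
theorem C_mul_formalCubic (e c₀ c₂ c₃ : R) (a b : R⟦X⟧) :
    PowerSeries.C e * formalCubic c₀ c₂ c₃ a b = formalCubic (e * c₀) (e * c₂) (e * c₃) a b := by
  simp only [formalCubic, map_mul]
  ring

/-- Scaling the defect: `e·defect(1, c₀, c₂, c₃) = defect(e, e c₀, e c₂, e c₃)` (clearing denominators of
`g₂ = c₄/12`, `g₃ = c₆/216`). [folklore] -/
theorem C_mul_formalDefect (e c₀ c₂ c₃ : R) (a b φ : R⟦X⟧) :
    PowerSeries.C e * formalDefect 1 c₀ c₂ c₃ a b φ = formalDefect e (e * c₀) (e * c₂) (e * c₃) a b φ := by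
  simp only [formalDefect, formalCubic, map_mul, map_one]
  ring

end Formal

/-! ## §3 Kernel-computable model: truncated coefficient lists

`l : List R` models the power series `∑_{n<M} l[n] qⁿ` (`l.getD n 0`, zero beyond the list); all operations keep
exactly `M` coefficients.  The `_spec` lemmas say: if the lists agree with power series `ψ` below `M` (through a ring
map `ι : R →+* S`, in the application `ℤ → ℂ`), so do the results.  Products are schoolbook on cons-lists
(`mulPoly`, `O(M²)` kernel steps each), so a whole level certificate is one `decide +kernel` of a few seconds. -/

section Lists

variable {R : Type*} [CommRing R] {S : Type*} [CommRing S]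

/-- Coefficientwise sum of coefficient lists (the longer tail is kept). [folklore] -/
def addPoly : List R → List R → List R
  | [], l => l
  | x :: xs, [] => x :: xs
  | x :: xs, y :: ys => (x + y) :: addPoly xs ys

/-- Schoolbook product of coefficient lists, structurally recursive (`O(|l₁|·|l₂|)` kernel steps, no random
access): `(x + X·p)·q = x·q + X·(p·q)`. [folklore] -/
def mulPoly : List R → List R → List R
  | [], _ => []
  | x :: xs, ys => addPoly (ys.map (x * ·)) (0 :: mulPoly xs ys)

/-- Truncated product of coefficient lists (first `M` coefficients). [folklore] -/
def mulList (M : ℕ) (l₁ l₂ : List R) : List R := (mulPoly l₁ l₂).take M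

/-- Truncated difference. [folklore] -/
def subList (M : ℕ) (l₁ l₂ : List R) : List R := (List.range M).map fun n ↦ l₁.getD n 0 - l₂.getD n 0

/-- Truncated scalar multiple. [folklore] -/
def smulList (M : ℕ) (c : R) (l : List R) : List R := (List.range M).map fun n ↦ c * l.getD n 0

/-- Truncated `θ = q·d/dq`. [folklore] -/
def thetaList (M : ℕ) (l : List R) : List R := (List.range M).map fun n : ℕ ↦ (n : R) * l.getD n 0

/-- Truncated bracket `θa·b − a·θb`. [folklore] -/
def bracketList (M : ℕ) (a b : List R) : List R :=
  subList M (mulList M (thetaList M a) b) (mulList M a (thetaList M b))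

/-- Truncated cubic `c₀a³ − c₂ab² − c₃b³`. [folklore] -/
def cubicList (M : ℕ) (c₀ c₂ c₃ : R) (a b : List R) : List R :=
  subList M (subList M (smulList M c₀ (mulList M (mulList M a a) a)) (smulList M c₂ (mulList M a (mulList M b b))))
    (smulList M c₃ (mulList M (mulList M b b) b))

/-- **Truncated defect** `e·[a,b]² − φ²·(c₀a³ − c₂ab² − c₃b³)·b` — the list a level file evaluates by `decide`.
[folklore] -/
def defectList (M : ℕ) (e c₀ c₂ c₃ : R) (a b φ : List R) : List R :=
  subList M (smulList M e (mulList M (bracketList M a b) (bracketList M a b)))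
    (mulList M (mulList M (mulList M φ φ) (cubicList M c₀ c₂ c₃ a b)) b)

omit [CommRing R] in
/-- Entries of a mapped range. [folklore] -/
theorem getD_map_range {α : Type*} [Zero α] (g : ℕ → α) {L n : ℕ} (hn : n < L) :
    ((List.range L).map g).getD n 0 = g n := by
  rw [List.getD_eq_getElem?_getD, List.getElem?_map, List.getElem?_range hn]
  rfl

omit [CommRing R] in
/-- A level file proves `defectList … = List.replicate M 0` by `decide +kernel` ONCE; this turns it into the
pointwise hypothesis `hzero` of the headline. [folklore] -/
theorem forall_getD_eq_zero_of_eq_replicate {α : Type*} [Zero α] {l : List α} {M : ℕ} (h : l = List.replicate M 0) :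
    ∀ n < M, l.getD n 0 = 0 := by
  intro n hn
  subst h
  simp [List.getD_eq_getElem?_getD, hn]

/-- Entries of `addPoly`. [folklore] -/
theorem getD_addPoly : ∀ (l₁ l₂ : List R) (n : ℕ), (addPoly l₁ l₂).getD n 0 = l₁.getD n 0 + l₂.getD n 0
  | [], l, n => by simp [addPoly]
  | x :: xs, [], n => by simp [addPoly]
  | x :: xs, y :: ys, 0 => by simp [addPoly]
  | x :: xs, y :: ys, n + 1 => by
    rw [addPoly, List.getD_cons_succ, List.getD_cons_succ, List.getD_cons_succ, getD_addPoly xs ys n]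

/-- Entries of a scaled list. [folklore] -/
theorem getD_map_mul (x : R) (l : List R) (n : ℕ) : (l.map (x * ·)).getD n 0 = x * l.getD n 0 := by
  rw [List.getD_eq_getElem?_getD, List.getElem?_map, List.getD_eq_getElem?_getD]
  cases l[n]? <;> simp

/-- Entries of `mulPoly` = Cauchy product coefficients. [folklore] -/
theorem getD_mulPoly : ∀ (l₁ l₂ : List R) (n : ℕ),
    (mulPoly l₁ l₂).getD n 0 = ∑ i ∈ Finset.range (n + 1), l₁.getD i 0 * l₂.getD (n - i) 0
  | [], l, n => by simp [mulPoly]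
  | x :: xs, ys, 0 => by
    rw [mulPoly, getD_addPoly, getD_map_mul, List.getD_cons_zero, add_zero, Nat.zero_add, Finset.sum_range_one,
      List.getD_cons_zero, Nat.sub_zero]
  | x :: xs, ys, n + 1 => by
    rw [mulPoly, getD_addPoly, getD_map_mul, List.getD_cons_succ, getD_mulPoly xs ys n,
      Finset.sum_range_succ' _ (n + 1)]
    simp only [List.getD_cons_succ, List.getD_cons_zero, Nat.add_sub_add_right, Nat.sub_zero]
    rw [add_comm]

/-- Entries of the truncated product. [folklore] -/
theorem getD_mulList (M : ℕ) (l₁ l₂ : List R) {n : ℕ} (hn : n < M) :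
    (mulList M l₁ l₂).getD n 0 = ∑ i ∈ Finset.range (n + 1), l₁.getD i 0 * l₂.getD (n - i) 0 := by
  rw [mulList, List.getD_eq_getElem?_getD, List.getElem?_take_of_lt hn, ← List.getD_eq_getElem?_getD, getD_mulPoly]

end Lists

/-! ## §4 Computable tables: `φ_δ^∧`, powers, shifts, sums, divisor lists, `η`-numerator / denominator -/

section EtaTables

/-- The unit list of length `M`. [folklore] -/
def oneList (M : ℕ) : List ℤ := (List.range M).map fun n ↦ if n = 0 then 1 else 0

/-- Truncated powers. [folklore] -/
def powList (M : ℕ) (l : List ℤ) : ℕ → List ℤ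
  | 0 => oneList M
  | s + 1 => mulList M (powList M l s) l

/-- Truncated multiplication by `X^a`. [folklore] -/
def shiftList (M a : ℕ) (l : List ℤ) : List ℤ :=
  (List.range M).map fun n ↦ if a ≤ n then l.getD (n - a) 0 else 0

/-- Truncated sum. [folklore] -/
def addList (M : ℕ) (l₁ l₂ : List ℤ) : List ℤ := (List.range M).map fun n ↦ l₁.getD n 0 + l₂.getD n 0

/-- The first `M` coefficients of `φ_δ^∧ = ∏_{n≥1}(1 − X^{δn}) = formalEulerScaled δ`, read off the kernel table
`EulerTables.eulerTruncList 1 M M` of `∏_{n≥1}(1 − Xⁿ)`. [cite: Apostol1990, Thm. 14.3] -/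
def eulerScaledList (M δ : ℕ) : List ℤ :=
  (List.range M).map fun n ↦ if δ ∣ n then (EulerTables.eulerTruncList 1 M M).getD (n / δ) 0 else 0

/-- The positive divisors of `N`, as a list. [folklore] -/
def divisorsList (N : ℕ) : List ℕ := (List.range (N + 1)).filter fun δ ↦ decide (0 < δ ∧ δ ∣ N)

/-- `∏_{δ ∈ L} (φ_δ^∧)^{s δ}`, truncated. [folklore] -/
def eulerProdList (M : ℕ) (s : ℕ → ℕ) : List ℕ → List ℤ
  | [] => oneList M
  | δ :: L => mulList M (powList M (eulerScaledList M δ) (s δ)) (eulerProdList M s L)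

/-- **NUMERATOR table** of the `η`-quotient with exponents `r` and `q`-shift `a`:
`X^a · ∏_{δ ∣ N} (φ_δ^∧)^{(r δ)⁺}`, truncated to `M` coefficients. [cite: Koehler2011, §2.1] -/
def etaNumList (M N : ℕ) (r : ℕ → ℤ) (a : ℕ) : List ℤ :=
  shiftList M a (eulerProdList M (fun δ ↦ (r δ).toNat) (divisorsList N))

/-- **DENOMINATOR table**: `∏_{δ ∣ N} (φ_δ^∧)^{(−r δ)⁺}`, truncated to `M` coefficients. [cite: Koehler2011, §2.1] -/
def etaDenList (M N : ℕ) (r : ℕ → ℤ) : List ℤ :=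
  eulerProdList M (fun δ ↦ (-r δ).toNat) (divisorsList N)

/-- The analytic side of `eulerProdList`: `∏_{δ ∈ L} φ_δ^{s δ}` as a function on `ℍ`. [folklore] -/
def eulerProdFn (s : ℕ → ℕ) : List ℕ → ℍ → ℂ
  | [] => 1
  | δ :: L => eulerFn δ ^ s δ * eulerProdFn s L

end EtaTables

end Summit.BirchSwinnertonDyer.BirchSwinnertonDyer.Theorems.ManinLocalTwoThree.BracketSturm

end
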